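import Literature.AlgebraicGeometry.Kloosterman2025.TwoPlanesNormalForm
import Literature.AlgebraicGeometry.Villaflor2022.RationalPeriodRatios
import HarnessLib

/-!
# Hypersurfaces of split type (Kloosterman 2025, Definition 5.1) and the Fermat hypersurface (§4.1)

R. Kloosterman, *On a conjecture on Hodge loci of linear combinations of linear subvarieties*, Rend. Circ. Mat. Palermo
(2) 74 (2025) = arXiv:2312.12363 [cite: Kloosterman2025], §4.1 (p. 10) and §5 (p. 14). Verbatim (held text):

> **Definition 5.1.** Let `X ⊂ ℙ^{2k+1}` be a hypersurface containing two `k`-planes intersecting in an `m`-plane. Let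
> `c = k − m`. We say that `X` is *split of codimension `c`* if there exist a coordinate transformation of `ℙ^{2k+1}` such
> that `X` is the zero set of `f ∈ ℂ[x_0,…,x_{2k+1}]` of the form `f = Σ_{i=0}^{c−1} Σ_{j=c}^{2c−1} x_i x_j Q_{ij} + Σ_j x_j P_j`
> and `Q_{ij} ∈ ℂ[x_0,…,x_{2c−1}]` for `0 ≤ i ≤ c−1`, `c ≤ j ≤ 2c−1`.
> **Remark 5.2.** If `X` contains two `k`-planes intersecting in an `(k−c)`-plane then we can always find a change of
> coordinates such that `X = V(f)`, with `f` [as above] and `Q_{ij} ∈ ℂ[x_0,…,x_{k+c+1}]`. In order to be of split type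
> requires the `Q_{ij}` to be contained in the subring `ℂ[x_0,…,x_{2c−1}]`. […] From the description of the Fermat
> hypersurface in Subsection 4.1 it follows that the Fermat hypersurface is of split type.
> **§4.1.** `X = V(Σ_{i=0}^{2k+1} x_i^d)`, `ζ` a primitive `2d`-th root of unity, `Π₁ = V({x_{2i} − ζx_{2i+1} : i = 0,…,k})`;
> fix `1 ≤ c ≤ k+1`, for `i < c` an odd integer `α_i` with `3 ≤ α_i ≤ 2d−1`, `α_i = 1` for `i = c,…,k`,
> `Π₂ = V({x_{2i} − ζ^{α_i}x_{2i+1}})`. "In the way `Π₁, Π₂ ⊂ X` and `dim Π₁ ∩ Π₂ = k − c`." In the coordinates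
> `y_{2i} = x_{2i} − ζx_{2i+1}`, `y_{2i+1} = x_{2i} − ζ^{α_i}x_{2i+1}` (differing pairs), `y_{2i+1} = x_{2i+1}` (common pairs):
> `f = Σ y_{2i} y_{2i+1} g_i(y_{2i}, y_{2i+1}) + Σ y_{2i} h_i(y_{2i}, y_{2i+1})`.

(The printed last index range `j = k+2+c, …, 2k+1` of Def. 5.1 / Rem. 5.2 has `k − c` terms; §4 (p. 10) and the count
`c + c + r = k + 1 + c` of plane equations give `r = k + 1 − c` common forms `x_{k+c+1}, …, x_{2k+1}` — the tree's
`stdPlacement`, as in `TwoPlanesNormalForm.lean`.)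

## What is formalised (all algebra; 0 facts, 0 sorry)

* `IsSplit d g h g' F` — Definition 5.1 relative to linear forms `g, h` (`c` each) and `g'` (`r`) cutting out the GIVEN
  planes `Π₁ = V(g, g')`, `Π₂ = V(h, g')`: `F = twoPlanesForm g h g' Q P` (the normal form of `TwoPlanesNormalForm.lean`:
  `Σ g_i h_j Q_{ij} + Σ g'_m P_m`, `deg Q = d−2`, `deg P = d−1`) with every `Q_{ij}` in the subalgebra `K[g, h]`.
  `IsSplit.exists_algEquiv_positions` recovers the printed form: a coordinate transformation `φ` placing `g, h, g'` at
  `x_0..x_{c−1}`, `x_c..x_{2c−1}`, `x_{k+c+1}..x_{2k+1}` with `φ⁻¹(F) = Σ x_i x_{c+j} Q_{ij} + Σ x_{k+c+1+m} P_m`,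
  `Q_{ij} ∈ K[x_0,…,x_{2c−1}]`. `IsSplit.mem_inf`: a split `F` lies in `I(Π₁) ∩ I(Π₂)`.
* **The choice of equations / coordinates does not matter** (so `IsSplit` IS the printed notion for the pair of planes):
  `IsSplit.map` (transport by a linear change of coordinates), `IsSplit.of_span_eq_span_X` and **`IsSplit.of_span_eq`**
  (if `(g₀, g₀') = (g, g')` and `(h₀, g₀') = (h, g')` as ideals — the same planes — and `g, h, g'` are linearly
  independent, then split w.r.t. `g₀, h₀, g₀'` ⇒ split w.r.t. `g, h, g'`; proof: kill the common coordinates `x_C`, the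
  `Q`-part lands in `K[x_A, x_B] ∩ (x_A) ∩ (x_B)` and is a `Σ x_a x_b Q'` by the normal form with `r = 0`, the rest lies in
  `(x_C)` and is a `Σ x_c P'` by the normal form with `c = 0`), and **`isSplit_iff_exists_algEquiv`**: `IsSplit d g h g' F`
  iff there is a linear coordinate change `φ` ADAPTED TO THE PAIR (`φ` maps the two coordinate `k`-planes onto
  `Π₁ = V(g, g')`, `Π₂ = V(h, g')`) with `φ⁻¹(F) = Σ x_i x_{c+j} Q_{ij} + Σ x_{k+c+1+m} P_m`, `Q_{ij} ∈ K[x_0,…,x_{2c−1}]` —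
  Definition 5.1 verbatim, the adaptedness to `Π₁, Π₂` (implicit in print) made explicit.
* §4.1: `pow_add_pow_eq_sub_mul_geom_sum` (`x^d + x'^d = (x − ax')·Σ x^i (ax')^{d−1−i}` for `a^d = −1`),
  `X_pow_add_X_pow_eq_mul_mul` (`x^d + x'^d = (x − ax')(x − bx')·q`, `a ≠ b` two `d`-th roots of `−1`, `q` explicit of
  degree `d−2` in `x, x'`), the planes `fermatPlaneA/B/C` (`x_{2i} − ζx_{2i+1}`, `x_{2i} − ζ^{α_i}x_{2i+1}`, common
  `x_{2i} − ζx_{2i+1}`), `fermatPlanes_linearIndependent` (`dim Π₁ ∩ Π₂ = k − c`), **`fermat_isSplit`** (the Fermat form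
  is `twoPlanesForm` of these planes with DIAGONAL `Q`, `Q_{ii} ∈ K[x_{2i}, x_{2i+1}] = K[g_i, h_i] ⊆ K[g, h]`),
  `fermat_isSplit_of_isPrimitiveRoot` (the printed hypotheses: `ζ` primitive `2d`-th root of unity, `α_i` odd,
  `3 ≤ α_i ≤ 2d−1`), `fermat_mem_inf` (`Π₁, Π₂ ⊂ X`), `fermat_exists_algEquiv_positions` (the printed coordinates).

Not formalised: Theorem 5.3 (reducibility of `NL([Π₁]+λ[Π₂])` near a split `X`) — it is Hodge-theoretic.

HONEST FRAMING (cell pub-hlocus): certified instances and evidence bearing on the general Hodge conjecture; no claim.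
-/

noncomputable section

open MvPolynomial Module

namespace Literature.AlgebraicGeometry.Kloosterman2025

/-! ## Definition 5.1 — hypersurfaces of split type -/

section SplitDef

variable {K : Type*} [Field K] {k c r : ℕ}

/-- **Kloosterman 2025, Definition 5.1 — `X` is split of codimension `c`** (with respect to the two `k`-planes
`Π₁ = V(g, g')`, `Π₂ = V(h, g')` meeting in a `(k−c)`-plane), stated in the tree's coordinate-free language: the form `F`
of degree `d` admits a normal form `F = Σ_{i,j} g_i h_j Q_{ij} + Σ_m g'_m P_m` (`twoPlanesForm g h g' Q P`, `Q_{ij}` of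
degree `d−2`, `P_m` of degree `d−1`) in which every `Q_{ij}` is a polynomial in the `2c` linear forms `g, h` ALONE
(`Q_{ij} ∈ K[g_0,…,g_{c−1},h_0,…,h_{c−1}]`). Printed: "there exist a coordinate transformation of `ℙ^{2k+1}` such that `X`
is the zero set of `f = Σ_{i=0}^{c−1} Σ_{j=c}^{2c−1} x_i x_j Q_{ij} + Σ_j x_j P_j` and `Q_{ij} ∈ ℂ[x_0, …, x_{2c−1}]`" —
the coordinate form is recovered in `IsSplit.exists_algEquiv_positions`. The predicate is stated relative to
EQUATIONS `g, h, g'` of the pair of planes, but depends only on the planes (`IsSplit.of_span_eq`), and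
`isSplit_iff_exists_algEquiv` identifies it with the printed "there exist a coordinate transformation [adapted to
`Π₁, Π₂`] such that …"; §4.1 exhibits it for the Fermat hypersurface (`fermat_isSplit`). [cite: Kloosterman2025, Definition 5.1] -/
def IsSplit (d : ℕ) (gA h : Fin c → MvPolynomial (Fin (2 * k + 2)) K) (gC : Fin r → MvPolynomial (Fin (2 * k + 2)) K)
    (F : MvPolynomial (Fin (2 * k + 2)) K) : Prop :=
  ∃ (Q : Fin c → Fin c → MvPolynomial (Fin (2 * k + 2)) K) (P : Fin r → MvPolynomial (Fin (2 * k + 2)) K),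
    (∀ i j, (Q i j).IsHomogeneous (d - 2)) ∧ (∀ m, (P m).IsHomogeneous (d - 1)) ∧
      (∀ i j, Q i j ∈ Algebra.adjoin K (Set.range gA ∪ Set.range h)) ∧ twoPlanesForm gA h gC Q P = F

/-- A split form lies in the ideal of `Π₁ ∪ Π₂`. [cite: Kloosterman2025, Definition 5.1, Remark 5.2] -/
theorem IsSplit.mem_inf {d : ℕ} {gA h : Fin c → MvPolynomial (Fin (2 * k + 2)) K}
    {gC : Fin r → MvPolynomial (Fin (2 * k + 2)) K} {F : MvPolynomial (Fin (2 * k + 2)) K}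
    (hF : IsSplit d gA h gC F) :
    F ∈ Ideal.span (Set.range gA ∪ Set.range gC) ⊓ Ideal.span (Set.range h ∪ Set.range gC) := by
  obtain ⟨Q, P, -, -, -, rfl⟩ := hF
  exact Ideal.mem_inf.mpr ⟨twoPlanesForm_mem_span_plane₁ gA h gC Q P, twoPlanesForm_mem_span_plane₂ gA h gC Q P⟩

/-- A split form of degree `d ≥ 2` is homogeneous of degree `d` when `g, h, g'` are linear forms.
[cite: Kloosterman2025, Definition 5.1] -/
theorem IsSplit.isHomogeneous {d : ℕ} (hd : 2 ≤ d) {gA h : Fin c → MvPolynomial (Fin (2 * k + 2)) K}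
    {gC : Fin r → MvPolynomial (Fin (2 * k + 2)) K} {F : MvPolynomial (Fin (2 * k + 2)) K}
    (hgA : ∀ i, (gA i).IsHomogeneous 1) (hh : ∀ j, (h j).IsHomogeneous 1) (hgC : ∀ m, (gC m).IsHomogeneous 1)
    (hF : IsSplit d gA h gC F) : F.IsHomogeneous d := by
  obtain ⟨Q, P, hQ, hP, -, rfl⟩ := hF
  exact isHomogeneous_twoPlanesForm hd hgA hh hgC hQ hP

/-- Two injective placements of finitely many labels among the variables differ by a permutation of the variables.
[folklore] -/
private theorem exists_perm_apply_eq' {ι : Type*} [Fintype ι] {n : ℕ} (e e' : ι ↪ Fin n) :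
    ∃ σ : Equiv.Perm (Fin n), ∀ s, σ (e s) = e' s := by
  classical
  let E : ↥(Set.range e) ≃ ↥(Set.range e') := e.toEquivRange.symm.trans e'.toEquivRange
  refine ⟨E.extendSubtype, fun s => ?_⟩
  rw [Equiv.extendSubtype_apply_of_mem E (e s) ⟨s, rfl⟩]
  change ((e'.toEquivRange (e.toEquivRange.symm ⟨e s, ⟨s, rfl⟩⟩) : ↥(Set.range e')) : Fin n) = e' s
  have h1 : e.toEquivRange.symm ⟨e s, ⟨s, rfl⟩⟩ = s := by
    rw [Equiv.symm_apply_eq]; ext; simp [Function.Embedding.toEquivRange_apply]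
  rw [h1]
  simp [Function.Embedding.toEquivRange_apply]

/-- An algebra automorphism of the polynomial ring is the substitution of the images of the variables. [folklore] -/
private theorem algEquiv_symm_eq_aeval' {n : ℕ} (φ : MvPolynomial (Fin n) K ≃ₐ[K] MvPolynomial (Fin n) K)
    (F : MvPolynomial (Fin n) K) : φ.symm F = aeval (fun l => φ.symm (X l)) F := by
  have h : (φ.symm : MvPolynomial (Fin n) K →ₐ[K] MvPolynomial (Fin n) K) = aeval fun l => φ.symm (X l) :=
    MvPolynomial.algHom_ext fun l => by simp
  exact congr($h F)

/-- **Definition 5.1 as printed: the coordinate transformation.** If `F` is split of codimension `c` with respect to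
linearly independent linear forms `g, h, g'` (`c + r = k + 1`), then there is a linear change of coordinates `φ`
(a `K`-algebra automorphism of `K[x_0, …, x_{2k+1}]`, `φ^{±1}` mapping variables to linear forms) with `φ(x_i) = g_i`
(`i < c`), `φ(x_{c+j}) = h_j` (`j < c`), `φ(x_{k+c+1+m}) = g'_m` (`m < r`) and forms `Q_{ij}` INVOLVING ONLY
`x_0, …, x_{2c−1}`, `P_m`, with `φ⁻¹(F) = Σ_{i<c} Σ_{j<c} x_i x_{c+j} Q_{ij} + Σ_{m<r} x_{k+c+1+m} P_m` — "there exist a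
coordinate transformation of `ℙ^{2k+1}` such that `X` is the zero set of `f = Σ x_i x_j Q_{ij} + Σ x_j P_j` and
`Q_{ij} ∈ ℂ[x_0, …, x_{2c−1}]`". [cite: Kloosterman2025, Definition 5.1, Remark 5.2] -/
theorem IsSplit.exists_algEquiv_positions {d : ℕ} (hcr : c + r = k + 1)
    {gA h : Fin c → MvPolynomial (Fin (2 * k + 2)) K} {gC : Fin r → MvPolynomial (Fin (2 * k + 2)) K}
    (hgA : ∀ i, (gA i).IsHomogeneous 1) (hh : ∀ j, (h j).IsHomogeneous 1) (hgC : ∀ m, (gC m).IsHomogeneous 1)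
    (hli : LinearIndependent K (Sum.elim (Sum.elim gA h) gC)) {F : MvPolynomial (Fin (2 * k + 2)) K}
    (hF : IsSplit d gA h gC F) :
    ∃ (φ : MvPolynomial (Fin (2 * k + 2)) K ≃ₐ[K] MvPolynomial (Fin (2 * k + 2)) K)
      (Q : Fin c → Fin c → MvPolynomial (Fin (2 * k + 2)) K) (P : Fin r → MvPolynomial (Fin (2 * k + 2)) K),
      (∀ l, (φ (X l)).IsHomogeneous 1) ∧ (∀ l, (φ.symm (X l)).IsHomogeneous 1) ∧
      (∀ i, φ (X (stdPlacement hcr (Sum.inl (Sum.inl i)))) = gA i) ∧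
      (∀ j, φ (X (stdPlacement hcr (Sum.inl (Sum.inr j)))) = h j) ∧
      (∀ m, φ (X (stdPlacement hcr (Sum.inr m))) = gC m) ∧
      (∀ i j, (Q i j).IsHomogeneous (d - 2)) ∧ (∀ m, (P m).IsHomogeneous (d - 1)) ∧
      (∀ i j, ∀ l ∈ (Q i j).vars, (l : ℕ) < 2 * c) ∧
      φ.symm F = twoPlanesForm (fun i => X (stdPlacement hcr (Sum.inl (Sum.inl i))))
        (fun j => X (stdPlacement hcr (Sum.inl (Sum.inr j)))) (fun m => X (stdPlacement hcr (Sum.inr m))) Q P := by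
  classical
  obtain ⟨Q, P, hQ, hP, hQadj, rfl⟩ := hF
  have h1 : ∀ s, (Sum.elim (Sum.elim gA h) gC s).IsHomogeneous 1 := by
    rintro ((i | j) | m)
    · exact hgA i
    · exact hh j
    · exact hgC m
  obtain ⟨φ₀, e, hφ₀, hφ₀1, hφ₀s1⟩ := exists_algEquiv_X_eq _ h1 hli
  obtain ⟨σ, hσ⟩ := exists_perm_apply_eq' e (stdPlacement hcr)
  have hσ' : ∀ s, σ.symm (stdPlacement hcr s) = e s := fun s => by rw [Equiv.symm_apply_eq, hσ]
  let ρ : MvPolynomial (Fin (2 * k + 2)) K ≃ₐ[K] MvPolynomial (Fin (2 * k + 2)) K := renameEquiv K σ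
  let φ := ρ.symm.trans φ₀
  have hφX : ∀ s, φ (X (stdPlacement hcr s)) = Sum.elim (Sum.elim gA h) gC s := fun s => by
    change φ₀ (ρ.symm (X _)) = _
    rw [renameEquiv_symm, renameEquiv_apply, rename_X, hσ', hφ₀]
  have hφ1 : ∀ l, (φ (X l)).IsHomogeneous 1 := fun l => by
    change (φ₀ (ρ.symm (X l))).IsHomogeneous 1
    rw [renameEquiv_symm, renameEquiv_apply, rename_X]; exact hφ₀1 _
  have hφs1 : ∀ l, (φ.symm (X l)).IsHomogeneous 1 := fun l => by
    change (ρ (φ₀.symm (X l))).IsHomogeneous 1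
    rw [renameEquiv_apply]; exact (hφ₀s1 l).rename_isHomogeneous (f := σ)
  have hsymm : ∀ s, φ.symm (Sum.elim (Sum.elim gA h) gC s) = X (stdPlacement hcr s) := fun s => by
    rw [← hφX s, AlgEquiv.symm_apply_apply]
  refine ⟨φ, fun i j => φ.symm (Q i j), fun m => φ.symm (P m), hφ1, hφs1, fun i => hφX (Sum.inl (Sum.inl i)),
    fun j => hφX (Sum.inl (Sum.inr j)), fun m => hφX (Sum.inr m), fun i j => ?_, fun m => ?_, fun i j l hl => ?_, ?_⟩
  · show (φ.symm (Q i j)).IsHomogeneous (d - 2)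
    rw [algEquiv_symm_eq_aeval']
    exact Literature.RingTheory.MvPolynomial.isHomogeneous_aeval_linear hφs1 (hQ i j)
  · show (φ.symm (P m)).IsHomogeneous (d - 1)
    rw [algEquiv_symm_eq_aeval']
    exact Literature.RingTheory.MvPolynomial.isHomogeneous_aeval_linear hφs1 (hP m)
  · -- `φ⁻¹(Q_{ij}) ∈ K[x_0, …, x_{2c−1}]`
    have hmem : φ.symm (Q i j) ∈ (Algebra.adjoin K (Set.range gA ∪ Set.range h)).map
        (φ.symm : MvPolynomial (Fin (2 * k + 2)) K →ₐ[K] MvPolynomial (Fin (2 * k + 2)) K) :=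
      Subalgebra.mem_map.mpr ⟨Q i j, hQadj i j, rfl⟩
    rw [AlgHom.map_adjoin] at hmem
    have hsub : (φ.symm : MvPolynomial (Fin (2 * k + 2)) K →ₐ[K] MvPolynomial (Fin (2 * k + 2)) K) ''
        (Set.range gA ∪ Set.range h) ⊆ X '' {l : Fin (2 * k + 2) | (l : ℕ) < 2 * c} := by
      rintro _ ⟨q, hq, rfl⟩
      rcases hq with ⟨i, rfl⟩ | ⟨j, rfl⟩
      · refine ⟨stdPlacement hcr (Sum.inl (Sum.inl i)), ?_, (hsymm (Sum.inl (Sum.inl i))).symm⟩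
        simp only [Set.mem_setOf_eq, stdPlacement_inl_inl]; omega
      · refine ⟨stdPlacement hcr (Sum.inl (Sum.inr j)), ?_, (hsymm (Sum.inl (Sum.inr j))).symm⟩
        simp only [Set.mem_setOf_eq, stdPlacement_inl_inr]; omega
    have hsup : φ.symm (Q i j) ∈ supported K {l : Fin (2 * k + 2) | (l : ℕ) < 2 * c} :=
      Algebra.adjoin_mono hsub hmem
    exact (mem_supported.mp hsup) hl
  · have hA' : ∀ i, φ.symm (gA i) = X (stdPlacement hcr (Sum.inl (Sum.inl i))) := fun i => hsymm (Sum.inl (Sum.inl i))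
    have hB' : ∀ j, φ.symm (h j) = X (stdPlacement hcr (Sum.inl (Sum.inr j))) := fun j => hsymm (Sum.inl (Sum.inr j))
    have hC' : ∀ m, φ.symm (gC m) = X (stdPlacement hcr (Sum.inr m)) := fun m => hsymm (Sum.inr m)
    simp only [twoPlanesForm, map_add, map_sum, map_mul, hA', hB', hC']

end SplitDef

/-! ## The Fermat hypersurface is of split type (§4.1 and the remark after Remark 5.2) -/

section FermatSplit

variable {K : Type*} [Field K] {σ : Type*}

/-- `x^d + x'^d = (x − a x') · Σ_{i<d} x^i (a x')^{d−1−i}` when `a^d = −1` (the factor of the Fermat binary form through a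
point of `Π_a = V(x − a x')`; §4.1: "`y_{2i} h_i(y_{2i}, y_{2i+1})`"). [cite: Kloosterman2025, §4.1 (proof of Prop. 4.1)] -/
theorem pow_add_pow_eq_sub_mul_geom_sum {d : ℕ} {a : K} (ha : a ^ d = -1) (u v : MvPolynomial σ K) :
    u ^ d + v ^ d = (u - C a * v) * ∑ i ∈ Finset.range d, u ^ i * (C a * v) ^ (d - 1 - i) := by
  rw [mul_comm, Commute.geom_sum₂_mul (Commute.all u (C a * v)) d, mul_pow, ← C_pow, ha, C_neg, C_1]
  ring

/-- The difference of two such cofactors is divisible by `x'`: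
`Σ_{i<d} x^i (a x')^{d−1−i} − Σ_{i<d} x^i (b x')^{d−1−i} = x' · Σ_{i<d−1} (a^{d−1−i} − b^{d−1−i}) x^i x'^{d−2−i}`. [folklore] -/
private theorem geom_sum_sub_geom_sum_eq {d : ℕ} (hd : 1 ≤ d) (a b : K) (u v : MvPolynomial σ K) :
    ∑ i ∈ Finset.range d, u ^ i * (C a * v) ^ (d - 1 - i) - ∑ i ∈ Finset.range d, u ^ i * (C b * v) ^ (d - 1 - i) =
      v * ∑ i ∈ Finset.range (d - 1), C (a ^ (d - 1 - i) - b ^ (d - 1 - i)) * u ^ i * v ^ (d - 2 - i) := by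
  obtain ⟨e, rfl⟩ : ∃ e, d = e + 1 := ⟨d - 1, by omega⟩
  simp only [Nat.add_sub_cancel]
  rw [← Finset.sum_sub_distrib, Finset.sum_range_succ, Nat.sub_self, pow_zero, pow_zero, sub_self, add_zero,
    Finset.mul_sum]
  refine Finset.sum_congr rfl fun i hi => ?_
  rw [Finset.mem_range] at hi
  obtain ⟨t, ht⟩ : ∃ t, e - i = t + 1 := ⟨e - i - 1, by omega⟩
  rw [show e + 1 - 2 - i = t by omega, ht, mul_pow, mul_pow, ← C_pow, ← C_pow, C_sub]
  ring

/-- **Two distinct factors**: for `a ≠ b` with `a^d = b^d = −1`,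
`x^d + x'^d = (x − a x')(x − b x') · q` with `q = (a−b)⁻¹ Σ_{i<d−1} (a^{d−1−i} − b^{d−1−i}) x^i x'^{d−2−i}` — the
quadratic factor `y_{2i} y_{2i+1}` of the Fermat binary form (§4.1: "`f = Σ y_{2i} y_{2i+1} g_i(y_{2i},y_{2i+1}) + …`"), for
`x, x'` two distinct VARIABLES. [cite: Kloosterman2025, §4.1 (proof of Prop. 4.1)] -/
theorem X_pow_add_X_pow_eq_mul_mul {d : ℕ} (hd : 1 ≤ d) {a b : K} (ha : a ^ d = -1) (hb : b ^ d = -1) (hab : a ≠ b)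
    (l l' : σ) :
    (X l : MvPolynomial σ K) ^ d + X l' ^ d = (X l - C a * X l') * (X l - C b * X l') *
      (C (a - b)⁻¹ * ∑ i ∈ Finset.range (d - 1), C (a ^ (d - 1 - i) - b ^ (d - 1 - i)) * X l ^ i * X l' ^ (d - 2 - i)) := by
  set u : MvPolynomial σ K := X l
  set v : MvPolynomial σ K := X l'
  set pa := ∑ i ∈ Finset.range d, u ^ i * (C a * v) ^ (d - 1 - i)
  set pb := ∑ i ∈ Finset.range d, u ^ i * (C b * v) ^ (d - 1 - i)
  set w := ∑ i ∈ Finset.range (d - 1), C (a ^ (d - 1 - i) - b ^ (d - 1 - i)) * u ^ i * v ^ (d - 2 - i)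
  have hA : u ^ d + v ^ d = (u - C a * v) * pa := pow_add_pow_eq_sub_mul_geom_sum ha u v
  have hB : u ^ d + v ^ d = (u - C b * v) * pb := pow_add_pow_eq_sub_mul_geom_sum hb u v
  have hdiff : pa - pb = v * w := geom_sum_sub_geom_sum_eq hd a b u v
  -- `v · ((u − a v) w − (a − b) p_b) = 0`, and `v = x'` is a non-zero-divisor
  have hkey : v * ((u - C a * v) * w - C (a - b) * pb) = 0 := by
    have h1 : (u - C a * v) * (v * w) = (u - C a * v) * pa - (u - C a * v) * pb := by rw [← mul_sub, hdiff]
    rw [C_sub]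
    linear_combination h1 - hA + hB
  have hv : v ≠ 0 := X_ne_zero l'
  have hw : (u - C a * v) * w = C (a - b) * pb := by
    have := (mul_eq_zero.mp hkey).resolve_left hv
    exact sub_eq_zero.mp this
  have hab' : (a - b) ≠ 0 := sub_ne_zero.mpr hab
  have hpb : pb = C (a - b)⁻¹ * ((u - C a * v) * w) := by
    rw [hw, ← mul_assoc, ← C_mul, inv_mul_cancel₀ hab', C_1, one_mul]
  rw [hB, hpb]
  ring

/-- The quadratic cofactor is a form of degree `d − 2`. [folklore] -/
private theorem isHomogeneous_pairCofactor {d : ℕ} (a b : K) {l l' : σ} :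
    (C (a - b)⁻¹ * ∑ i ∈ Finset.range (d - 1), C (a ^ (d - 1 - i) - b ^ (d - 1 - i)) * (X l : MvPolynomial σ K) ^ i *
      X l' ^ (d - 2 - i)).IsHomogeneous (d - 2) := by
  have hsum : (∑ i ∈ Finset.range (d - 1), C (a ^ (d - 1 - i) - b ^ (d - 1 - i)) * (X l : MvPolynomial σ K) ^ i *
      X l' ^ (d - 2 - i)).IsHomogeneous (d - 2) := by
    refine IsHomogeneous.sum _ _ _ fun i hi => ?_
    rw [Finset.mem_range] at hi
    have h := ((isHomogeneous_C σ (a ^ (d - 1 - i) - b ^ (d - 1 - i))).mul ((isHomogeneous_X K l).pow i)).mul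
      ((isHomogeneous_X K l').pow (d - 2 - i))
    convert h using 1; omega
  have h := (isHomogeneous_C σ (a - b)⁻¹).mul hsum
  convert h using 1; omega

/-- The linear cofactor is a form of degree `d − 1`. [folklore] -/
private theorem isHomogeneous_geom_sum {d : ℕ} (a : K) {l l' : σ} :
    (∑ i ∈ Finset.range d, (X l : MvPolynomial σ K) ^ i * (C a * X l') ^ (d - 1 - i)).IsHomogeneous (d - 1) := by
  refine IsHomogeneous.sum _ _ _ fun i hi => ?_
  rw [Finset.mem_range] at hi
  have h := ((isHomogeneous_X K l).pow i).mul (((isHomogeneous_C σ a).mul (isHomogeneous_X K l')).pow (d - 1 - i))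
  convert h using 1; omega

variable {k c r : ℕ}

/-- The even coordinate `x_{2i}` of the `i`-th pair (`i ≤ k`) of coordinates on `ℙ^{2k+1}`.
[cite: Kloosterman2025, §4.1] -/
def pairFst (i : Fin (k + 1)) : Fin (2 * k + 2) := ⟨2 * i, by omega⟩

/-- The odd coordinate `x_{2i+1}` of the `i`-th pair (`i ≤ k`). [cite: Kloosterman2025, §4.1] -/
def pairSnd (i : Fin (k + 1)) : Fin (2 * k + 2) := ⟨2 * i + 1, by omega⟩

/-- The linear form `x_{2p} − t·x_{2p+1}` on the `p`-th pair of coordinates (§4.1's `x_{2i} − ζ^{α_i} x_{2i+1}`).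
[cite: Kloosterman2025, §4.1] -/
def pairForm (p : Fin (k + 1)) (t : K) : MvPolynomial (Fin (2 * k + 2)) K := X (pairFst p) - C t * X (pairSnd p)

/-- A pair form is a linear form. [cite: Kloosterman2025, §4.1] -/
theorem isHomogeneous_pairForm (p : Fin (k + 1)) (t : K) : (pairForm p t).IsHomogeneous 1 :=
  (isHomogeneous_X K _).sub ((isHomogeneous_C _ t).mul (isHomogeneous_X K _))

/-- §4.1's first plane `Π₁ = V(x_{2i} − ζ x_{2i+1} : i ≤ k)`: its `c` forms on the pairs `i < c` where the two planes
differ. [cite: Kloosterman2025, §4.1] -/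
def fermatPlaneA (hcr : c + r = k + 1) (ζ : K) (i : Fin c) : MvPolynomial (Fin (2 * k + 2)) K :=
  pairForm (Fin.castLE (by omega) i) ζ

/-- §4.1's second plane `Π₂ = V(x_{2i} − ζ^{α_i} x_{2i+1} : i ≤ k)`: its forms on the differing pairs `i < c` (`α_i` odd,
`3 ≤ α_i ≤ 2d−1`). [cite: Kloosterman2025, §4.1] -/
def fermatPlaneB (hcr : c + r = k + 1) (ζ : K) (α : Fin c → ℕ) (j : Fin c) : MvPolynomial (Fin (2 * k + 2)) K :=
  pairForm (Fin.castLE (by omega) j) (ζ ^ α j)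

/-- The common forms `x_{2i} − ζ x_{2i+1}`, `i = c, …, k` (`α_i = 1` there), cutting out both planes.
[cite: Kloosterman2025, §4.1] -/
def fermatPlaneC (hcr : c + r = k + 1) (ζ : K) (m : Fin r) : MvPolynomial (Fin (2 * k + 2)) K :=
  pairForm (Fin.cast hcr (Fin.natAdd c m)) ζ

/-! ### The `k+1+c` plane forms are linearly independent (`dim Π₁ ∩ Π₂ = k − c`) -/

/-- `x_{2p} = x_{2q}` iff `p = q`. [folklore] -/
private theorem pairFst_inj {p q : Fin (k + 1)} : (pairFst p : Fin (2 * k + 2)) = pairFst q ↔ p = q := by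
  refine ⟨fun h => Fin.ext ?_, fun h => h ▸ rfl⟩
  have := congrArg Fin.val h
  change 2 * (p : ℕ) = 2 * q at this
  omega

/-- `x_{2p+1} = x_{2q+1}` iff `p = q`. [folklore] -/
private theorem pairSnd_inj {p q : Fin (k + 1)} : (pairSnd p : Fin (2 * k + 2)) = pairSnd q ↔ p = q := by
  refine ⟨fun h => Fin.ext ?_, fun h => h ▸ rfl⟩
  have := congrArg Fin.val h
  change 2 * (p : ℕ) + 1 = 2 * q + 1 at this
  omega

/-- An even coordinate is not an odd one. [folklore] -/
private theorem pairFst_ne_pairSnd (p q : Fin (k + 1)) : (pairFst p : Fin (2 * k + 2)) ≠ pairSnd q :=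
  Fin.ne_of_val_ne (by change 2 * (p : ℕ) ≠ 2 * q + 1; omega)

/-- An odd coordinate is not an even one. [folklore] -/
private theorem pairSnd_ne_pairFst (p q : Fin (k + 1)) : (pairSnd p : Fin (2 * k + 2)) ≠ pairFst q :=
  (pairFst_ne_pairSnd q p).symm

/-- Coefficient of `x_{2p}` in a pair form. [folklore] -/
private theorem coeff_pairFst_pairForm (p q : Fin (k + 1)) (t : K) :
    coeff (Finsupp.single (pairFst p) 1) (pairForm q t) = if q = p then 1 else 0 := by
  classical
  simp only [pairForm, coeff_sub, coeff_C_mul, coeff_X, Finsupp.single_left_inj (one_ne_zero : (1 : ℕ) ≠ 0),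
    pairFst_inj, pairSnd_ne_pairFst, if_false, mul_zero, sub_zero]

/-- Coefficient of `x_{2p+1}` in a pair form. [folklore] -/
private theorem coeff_pairSnd_pairForm (p q : Fin (k + 1)) (t : K) :
    coeff (Finsupp.single (pairSnd p) 1) (pairForm q t) = if q = p then -t else 0 := by
  classical
  simp only [pairForm, coeff_sub, coeff_C_mul, coeff_X, Finsupp.single_left_inj (one_ne_zero : (1 : ℕ) ≠ 0),
    pairSnd_inj, pairFst_ne_pairSnd, if_false, zero_sub, mul_ite, mul_one, mul_zero]
  split_ifs <;> simp

/-- **`dim Π₁ ∩ Π₂ = k − c`**: the `c + c + (k+1−c)` linear forms cutting out §4.1's planes `Π₁ = V(g, g')`,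
`Π₂ = V(h, g')` are linearly independent as soon as `ζ^{α_i} ≠ ζ` for `i < c` ("In the way `Π₁, Π₂ ⊂ X` and
`dim Π₁ ∩ Π₂ = k − c`"). [cite: Kloosterman2025, §4.1] -/
theorem fermatPlanes_linearIndependent (hcr : c + r = k + 1) (ζ : K) (α : Fin c → ℕ) (hα' : ∀ i, ζ ^ α i ≠ ζ) :
    LinearIndependent K (Sum.elim (Sum.elim (fermatPlaneA hcr ζ) (fermatPlaneB hcr ζ α)) (fermatPlaneC hcr ζ)) := by
  classical
  rw [Fintype.linearIndependent_iff]
  intro g hg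
  -- apply the coefficient functionals of `x_{2p}`, `x_{2p+1}` to the relation
  have hco : ∀ w : Fin (2 * k + 2) →₀ ℕ,
      ∑ i, g (Sum.inl (Sum.inl i)) * coeff w (fermatPlaneA hcr ζ i) +
        ∑ j, g (Sum.inl (Sum.inr j)) * coeff w (fermatPlaneB hcr ζ α j) +
        ∑ m, g (Sum.inr m) * coeff w (fermatPlaneC hcr ζ m) = 0 := fun w => by
    have := congr_arg (coeff w) hg
    simpa only [coeff_add, coeff_sum, coeff_smul, smul_eq_mul, coeff_zero, Fintype.sum_sum_type, Sum.elim_inl,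
      Sum.elim_inr] using this
  have hAC : ∀ (i : Fin c) (m : Fin r), Fin.castLE (by omega : c ≤ k + 1) i ≠ Fin.cast hcr (Fin.natAdd c m) :=
    fun i m => Fin.ne_of_val_ne (by change (i : ℕ) ≠ c + m; omega)
  -- the differing pairs: `g_A + g_B = 0` and `−ζ g_A − ζ^{α_i} g_B = 0`
  have hAB : ∀ i, g (Sum.inl (Sum.inl i)) = 0 ∧ g (Sum.inl (Sum.inr i)) = 0 := by
    intro i
    have h1 := hco (Finsupp.single (pairFst (Fin.castLE (by omega : c ≤ k + 1) i)) 1)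
    have h2 := hco (Finsupp.single (pairSnd (Fin.castLE (by omega : c ≤ k + 1) i)) 1)
    simp only [fermatPlaneA, fermatPlaneB, fermatPlaneC, coeff_pairFst_pairForm, coeff_pairSnd_pairForm,
      Fin.castLE_inj, (hAC _ _).symm, if_false, mul_ite, mul_one, mul_zero, Finset.sum_ite_eq', Finset.mem_univ,
      if_true, Finset.sum_const_zero, add_zero] at h1 h2
    have hne : ζ - ζ ^ α i ≠ 0 := sub_ne_zero.mpr (hα' i).symm
    have hB : g (Sum.inl (Sum.inr i)) = 0 := by
      have : (ζ - ζ ^ α i) * g (Sum.inl (Sum.inr i)) = 0 := by linear_combination ζ * h1 + h2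
      exact (mul_eq_zero.mp this).resolve_left hne
    exact ⟨by linear_combination h1 - hB, hB⟩
  -- the common pairs: `g_C = 0`
  have hC : ∀ m, g (Sum.inr m) = 0 := by
    intro m
    have h1 := hco (Finsupp.single (pairFst (Fin.cast hcr (Fin.natAdd c m))) 1)
    simp only [fermatPlaneA, fermatPlaneB, fermatPlaneC, coeff_pairFst_pairForm, hAC, if_false, mul_zero,
      Finset.sum_const_zero, zero_add, Fin.cast_inj, Fin.natAdd_inj, mul_ite, mul_one, Finset.sum_ite_eq',
      Finset.mem_univ, if_true] at h1
    exact h1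
  rintro ((i | j) | m)
  · exact (hAB i).1
  · exact (hAB j).2
  · exact hC m

/-- The Fermat form summed over pairs: `Σ_l x_l^d = Σ_{i ≤ k} (x_{2i}^d + x_{2i+1}^d)`. [cite: Kloosterman2025, §4.1] -/
theorem sum_X_pow_eq_sum_pairs (d : ℕ) :
    (∑ l : Fin (2 * k + 2), (X l : MvPolynomial (Fin (2 * k + 2)) K) ^ d) =
      ∑ i : Fin (k + 1), ((X (pairFst i) : MvPolynomial (Fin (2 * k + 2)) K) ^ d + X (pairSnd i) ^ d) := by
  let e : Fin (k + 1) × Fin 2 ≃ Fin (2 * k + 2) := finProdFinEquiv.trans (finCongr (by ring))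
  have hval : ∀ p : Fin (k + 1) × Fin 2, ((e p : Fin (2 * k + 2)) : ℕ) = p.2 + 2 * p.1 := fun p => by simp [e]
  rw [← Fintype.sum_equiv e (fun p => (X (e p) : MvPolynomial (Fin (2 * k + 2)) K) ^ d) _ (fun _ => rfl),
    Fintype.sum_prod_type]
  refine Finset.sum_congr rfl fun i _ => ?_
  have h0 : e (i, 0) = pairFst i := Fin.ext (by rw [hval]; simp [pairFst])
  have h1 : e (i, 1) = pairSnd i := Fin.ext (by rw [hval]; simp only [pairSnd, Fin.val_one]; omega)
  rw [Fin.sum_univ_two, h0, h1]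

/-- Splitting a sum over the pairs `i ≤ k` into the `c` differing pairs and the `r = k+1−c` common ones. [folklore] -/
private theorem sum_pairs_split (hcr : c + r = k + 1) (f : Fin (k + 1) → MvPolynomial (Fin (2 * k + 2)) K) :
    ∑ i : Fin (k + 1), f i =
      ∑ i : Fin c, f (Fin.castLE (by omega) i) + ∑ m : Fin r, f (Fin.cast hcr (Fin.natAdd c m)) := by
  let e : Fin c ⊕ Fin r ≃ Fin (k + 1) := finSumFinEquiv.trans (finCongr hcr)
  rw [← Fintype.sum_equiv e (fun s => f (e s)) f (fun _ => rfl), Fintype.sum_sum_type]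
  congr 1

/-- **The Fermat hypersurface is of split type** ("From the description of the Fermat hypersurface in Subsection 4.1 it
follows that the Fermat hypersurface is of split type"): for `ζ` with `ζ^d = −1` (a primitive `2d`-th root of unity) and
exponents `α_i` with `(ζ^{α_i})^d = −1`, `ζ^{α_i} ≠ ζ` (`α_i` odd, `3 ≤ α_i ≤ 2d−1`), the Fermat form `Σ_l x_l^d` is
`twoPlanesForm g h g' Q P` for §4.1's planes with DIAGONAL `Q`, `Q_{ii} ∈ K[x_{2i}, x_{2i+1}] = K[g_i, h_i]`:
`x_{2i}^d + x_{2i+1}^d = (x_{2i} − ζx_{2i+1})(x_{2i} − ζ^{α_i}x_{2i+1}) Q_{ii}` (`i < c`) and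
`x_{2i}^d + x_{2i+1}^d = (x_{2i} − ζx_{2i+1}) P_i` (`i ≥ c`). [cite: Kloosterman2025, §4.1 (p. 10) and §5 (p. 14, the paragraph after Remark 5.2)] -/
theorem fermat_isSplit {d : ℕ} (hd : 1 ≤ d) (hcr : c + r = k + 1) {ζ : K} (hζ : ζ ^ d = -1) (α : Fin c → ℕ)
    (hα : ∀ i, (ζ ^ α i) ^ d = -1) (hα' : ∀ i, ζ ^ α i ≠ ζ) :
    IsSplit d (fermatPlaneA hcr ζ) (fermatPlaneB hcr ζ α) (fermatPlaneC hcr ζ)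
      (∑ l : Fin (2 * k + 2), (X l : MvPolynomial (Fin (2 * k + 2)) K) ^ d) := by
  classical
  -- the diagonal quadratic cofactors and the linear cofactors
  let q : Fin c → MvPolynomial (Fin (2 * k + 2)) K := fun i =>
    C (ζ - ζ ^ α i)⁻¹ * ∑ t ∈ Finset.range (d - 1), C (ζ ^ (d - 1 - t) - (ζ ^ α i) ^ (d - 1 - t)) *
      X (pairFst (Fin.castLE (by omega : c ≤ k + 1) i)) ^ t * X (pairSnd (Fin.castLE (by omega : c ≤ k + 1) i)) ^ (d - 2 - t)
  let p : Fin r → MvPolynomial (Fin (2 * k + 2)) K := fun m =>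
    ∑ t ∈ Finset.range d, X (pairFst (Fin.cast hcr (Fin.natAdd c m))) ^ t *
      (C ζ * X (pairSnd (Fin.cast hcr (Fin.natAdd c m)))) ^ (d - 1 - t)
  refine ⟨fun i j => if i = j then q i else 0, p, fun i j => ?_, fun m => isHomogeneous_geom_sum ζ,
    fun i j => ?_, ?_⟩
  · dsimp only
    split_ifs
    · exact isHomogeneous_pairCofactor _ _
    · exact isHomogeneous_zero _ _ _
  · dsimp only
    split_ifs with hij
    · -- `x_{2i}, x_{2i+1} ∈ span(g_i, h_i)` since `ζ ≠ ζ^{α_i}`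
      set A := Algebra.adjoin K (Set.range (fermatPlaneA hcr ζ) ∪ Set.range (fermatPlaneB hcr ζ α)) with hA
      have hgi : fermatPlaneA hcr ζ i ∈ A := Algebra.subset_adjoin (Or.inl ⟨i, rfl⟩)
      have hhi : fermatPlaneB hcr ζ α i ∈ A := Algebra.subset_adjoin (Or.inr ⟨i, rfl⟩)
      have hne : ζ ^ α i - ζ ≠ 0 := sub_ne_zero.mpr (hα' i)
      have hsnd : (X (pairSnd (Fin.castLE (by omega : c ≤ k + 1) i)) : MvPolynomial (Fin (2 * k + 2)) K) ∈ A := by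
        have h1 : (X (pairSnd (Fin.castLE (by omega : c ≤ k + 1) i)) : MvPolynomial (Fin (2 * k + 2)) K) =
            C (ζ ^ α i - ζ)⁻¹ * (fermatPlaneA hcr ζ i - fermatPlaneB hcr ζ α i) := by
          simp only [fermatPlaneA, fermatPlaneB, pairForm]
          rw [show ∀ u v : MvPolynomial (Fin (2 * k + 2)) K, u - C ζ * v - (u - C (ζ ^ α i) * v) = C (ζ ^ α i - ζ) * v
            from fun u v => by rw [C_sub]; ring, ← mul_assoc, ← C_mul, inv_mul_cancel₀ hne, C_1, one_mul]
        rw [h1]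
        exact A.mul_mem (A.algebraMap_mem _) (A.sub_mem hgi hhi)
      have hfst : (X (pairFst (Fin.castLE (by omega : c ≤ k + 1) i)) : MvPolynomial (Fin (2 * k + 2)) K) ∈ A := by
        have h1 : (X (pairFst (Fin.castLE (by omega : c ≤ k + 1) i)) : MvPolynomial (Fin (2 * k + 2)) K) =
            fermatPlaneA hcr ζ i + C ζ * X (pairSnd (Fin.castLE (by omega : c ≤ k + 1) i)) := by
          simp only [fermatPlaneA, pairForm]; ring
        rw [h1]
        exact A.add_mem hgi (A.mul_mem (A.algebraMap_mem _) hsnd)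
      refine A.mul_mem (A.algebraMap_mem _) (A.sum_mem fun t _ => ?_)
      exact A.mul_mem (A.mul_mem (A.algebraMap_mem _) (A.pow_mem hfst _)) (A.pow_mem hsnd _)
    · exact Subalgebra.zero_mem _
  · -- the identity `Σ x_l^d = twoPlanesForm g h g' Q P`
    rw [sum_X_pow_eq_sum_pairs, sum_pairs_split hcr, twoPlanesForm]
    congr 1
    · refine Finset.sum_congr rfl fun i _ => ?_
      rw [Finset.sum_eq_single i (fun j _ hji => by rw [if_neg (Ne.symm hji), mul_zero])
        (fun hi => absurd (Finset.mem_univ i) hi), if_pos rfl]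
      have hab : ζ ≠ ζ ^ α i := fun h => hα' i h.symm
      exact (X_pow_add_X_pow_eq_mul_mul hd hζ (hα i) hab _ _).symm
    · refine Finset.sum_congr rfl fun m _ => ?_
      exact (pow_add_pow_eq_sub_mul_geom_sum hζ _ _).symm

/-- **§4.1 with its printed hypotheses**: for `ζ` a primitive `2d`-th root of unity (`d ≥ 1`) and odd integers `α_i`
with `3 ≤ α_i ≤ 2d − 1` (`i < c`; `α_i = 1` for `c ≤ i ≤ k` is built into `fermatPlaneC`), the Fermat form
`Σ_l x_l^d` is split of codimension `c` with respect to `Π₁ = V(x_{2i} − ζx_{2i+1})`, `Π₂ = V(x_{2i} − ζ^{α_i}x_{2i+1})`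
(`ζ^d = −1`, `(ζ^{α_i})^d = −1`, `ζ^{α_i} ≠ ζ`, then `fermat_isSplit`).
[cite: Kloosterman2025, §4.1 (p. 10) and §5 (p. 14, the paragraph after Remark 5.2)] -/
theorem fermat_isSplit_of_isPrimitiveRoot {d : ℕ} (hd : 1 ≤ d) (hcr : c + r = k + 1) {ζ : K}
    (hζ : IsPrimitiveRoot ζ (2 * d)) (α : Fin c → ℕ) (hodd : ∀ i, Odd (α i)) (h3 : ∀ i, 3 ≤ α i)
    (h2d : ∀ i, α i ≤ 2 * d - 1) :
    IsSplit d (fermatPlaneA hcr ζ) (fermatPlaneB hcr ζ α) (fermatPlaneC hcr ζ)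
      (∑ l : Fin (2 * k + 2), (X l : MvPolynomial (Fin (2 * k + 2)) K) ^ d) := by
  have hζd : ζ ^ d = -1 := Literature.AlgebraicGeometry.Villaflor2022.pow_eq_neg_one_of_isPrimitiveRoot_two_mul hd hζ
  refine fermat_isSplit hd hcr hζd α (fun i => ?_) (fun i h => ?_)
  · obtain ⟨t, ht⟩ := hodd i
    calc (ζ ^ α i) ^ d = (ζ ^ (2 * d)) ^ t * ζ ^ d := by rw [ht]; ring
      _ = -1 := by rw [hζ.pow_eq_one, one_pow, one_mul, hζd]
  · -- `ζ^{α_i} = ζ` would give `ζ^{α_i − 1} = 1`, i.e. `2d ∣ α_i − 1` with `2 ≤ α_i − 1 ≤ 2d − 2`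
    have h3i := h3 i
    have h2di := h2d i
    have hζ0 : ζ ≠ 0 := hζ.ne_zero (by omega)
    have h1 : ζ ^ (α i - 1) = 1 := by
      have : ζ ^ (α i - 1) * ζ = 1 * ζ := by rw [← pow_succ, Nat.sub_add_cancel (by omega), h, one_mul]
      exact mul_right_cancel₀ hζ0 this
    have hle := Nat.le_of_dvd (by omega) ((hζ.pow_eq_one_iff_dvd _).mp h1)
    omega

/-- `Π₁, Π₂ ⊂ X` for the Fermat hypersurface: `Σ_l x_l^d ∈ I(Π₁) ∩ I(Π₂)` for §4.1's planes.
[cite: Kloosterman2025, §4.1] -/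
theorem fermat_mem_inf {d : ℕ} (hd : 1 ≤ d) (hcr : c + r = k + 1) {ζ : K} (hζ : ζ ^ d = -1) (α : Fin c → ℕ)
    (hα : ∀ i, (ζ ^ α i) ^ d = -1) (hα' : ∀ i, ζ ^ α i ≠ ζ) :
    (∑ l : Fin (2 * k + 2), (X l : MvPolynomial (Fin (2 * k + 2)) K) ^ d) ∈
      Ideal.span (Set.range (fermatPlaneA hcr ζ) ∪ Set.range (fermatPlaneC hcr ζ)) ⊓
        Ideal.span (Set.range (fermatPlaneB hcr ζ α) ∪ Set.range (fermatPlaneC hcr ζ)) :=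
  (fermat_isSplit hd hcr hζ α hα hα').mem_inf

/-- **The Fermat hypersurface is of split type, in the printed coordinates**: there is a linear change of coordinates
`φ` with `φ(x_i) = x_{2i} − ζx_{2i+1}`, `φ(x_{c+i}) = x_{2i} − ζ^{α_i}x_{2i+1}` (`i < c`), `φ(x_{k+c+1+m}) = x_{2(c+m)} − ζx_{2(c+m)+1}`
(`m < k+1−c`) and forms `Q_{ij} ∈ K[x_0, …, x_{2c−1}]`, `P_m` with
`φ⁻¹(Σ_l x_l^d) = Σ_{i<c} Σ_{j<c} x_i x_{c+j} Q_{ij} + Σ_m x_{k+c+1+m} P_m` (§4.1's coordinates `y`, up to the order of the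
variables; `fermat_isSplit` + `fermatPlanes_linearIndependent` + `IsSplit.exists_algEquiv_positions`).
[cite: Kloosterman2025, §4.1 (p. 10) and §5 (p. 14, the paragraph after Remark 5.2)] -/
theorem fermat_exists_algEquiv_positions {d : ℕ} (hd : 1 ≤ d) (hcr : c + r = k + 1) {ζ : K} (hζ : ζ ^ d = -1)
    (α : Fin c → ℕ) (hα : ∀ i, (ζ ^ α i) ^ d = -1) (hα' : ∀ i, ζ ^ α i ≠ ζ) :
    ∃ (φ : MvPolynomial (Fin (2 * k + 2)) K ≃ₐ[K] MvPolynomial (Fin (2 * k + 2)) K)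
      (Q : Fin c → Fin c → MvPolynomial (Fin (2 * k + 2)) K) (P : Fin r → MvPolynomial (Fin (2 * k + 2)) K),
      (∀ l, (φ (X l)).IsHomogeneous 1) ∧ (∀ l, (φ.symm (X l)).IsHomogeneous 1) ∧
      (∀ i, φ (X (stdPlacement hcr (Sum.inl (Sum.inl i)))) = fermatPlaneA hcr ζ i) ∧
      (∀ j, φ (X (stdPlacement hcr (Sum.inl (Sum.inr j)))) = fermatPlaneB hcr ζ α j) ∧
      (∀ m, φ (X (stdPlacement hcr (Sum.inr m))) = fermatPlaneC hcr ζ m) ∧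
      (∀ i j, (Q i j).IsHomogeneous (d - 2)) ∧ (∀ m, (P m).IsHomogeneous (d - 1)) ∧
      (∀ i j, ∀ l ∈ (Q i j).vars, (l : ℕ) < 2 * c) ∧
      φ.symm (∑ l : Fin (2 * k + 2), (X l : MvPolynomial (Fin (2 * k + 2)) K) ^ d) =
        twoPlanesForm (fun i => X (stdPlacement hcr (Sum.inl (Sum.inl i))))
          (fun j => X (stdPlacement hcr (Sum.inl (Sum.inr j)))) (fun m => X (stdPlacement hcr (Sum.inr m))) Q P :=
  (fermat_isSplit hd hcr hζ α hα hα').exists_algEquiv_positions hcr (fun _ => isHomogeneous_pairForm _ _)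
    (fun _ => isHomogeneous_pairForm _ _) (fun _ => isHomogeneous_pairForm _ _)
    (fermatPlanes_linearIndependent hcr ζ α hα')

end FermatSplit

/-! ## Definition 5.1 as printed: the choice of equations / coordinates does not matter -/

section Invariance

variable {K : Type*} [Field K] {σ : Type*}

/-- The monomials of a linear form are single variables. [folklore] -/
private theorem exists_eq_single_of_mem_support {p : MvPolynomial σ K} (hp : p.IsHomogeneous 1) {m : σ →₀ ℕ}
    (hm : m ∈ p.support) : ∃ a, m = Finsupp.single a 1 := by
  by_contra h
  exact (mem_support_iff.mp hm) (hp.coeff_eq_zero fun hdeg => h ((Finsupp.sum_eq_one_iff m).mp hdeg))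

/-- A linear form in the ideal `(x_i : i ∈ T)` involves only the variables of `T`. [folklore] -/
private theorem vars_subset_of_mem_span_X {T : Set σ} {p : MvPolynomial σ K} (hp : p.IsHomogeneous 1)
    (hmem : p ∈ Ideal.span (X '' T : Set (MvPolynomial σ K))) : (↑p.vars : Set σ) ⊆ T := by
  classical
  intro l hl
  rw [Finset.mem_coe, mem_vars_iff_mem_support] at hl
  obtain ⟨m, hm, hlm⟩ := hl
  obtain ⟨a, rfl⟩ := exists_eq_single_of_mem_support hp hm
  obtain ⟨i, hiT, hi⟩ := mem_ideal_span_X_image.mp hmem _ hm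
  rw [Finsupp.single_apply] at hi
  split_ifs at hi with hai
  · obtain ⟨rfl, -⟩ := (Finsupp.mem_support_single _ _ _).mp hlm
    rw [hai]; exact hiT
  · exact absurd rfl hi

/-- A linear form involving only the variables of `T` lies in the ideal `(x_i : i ∈ T)`. [folklore] -/
private theorem mem_span_X_of_vars_subset {T : Set σ} {p : MvPolynomial σ K} (hp : p.IsHomogeneous 1)
    (hv : (↑p.vars : Set σ) ⊆ T) : p ∈ Ideal.span (X '' T : Set (MvPolynomial σ K)) := by
  classical
  refine mem_ideal_span_X_image.mpr fun m hm => ?_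
  obtain ⟨a, rfl⟩ := exists_eq_single_of_mem_support hp hm
  refine ⟨a, hv ?_, by simp⟩
  rw [Finset.mem_coe, mem_vars_iff_mem_support]
  exact ⟨_, hm, by simp⟩

variable (C : Set σ) [DecidablePred (· ∈ C)]

/-- `killVars C` on a variable (the landed API of `killVars` is private to `TwoPlanesNormalForm.lean`). [folklore] -/
private theorem killVars_X' (i : σ) : killVars (K := K) C (X i) = if i ∈ C then 0 else X i := by
  rw [killVars, aeval_X]

/-- Killing coordinates preserves forms of degree `m`. [folklore] -/
private theorem isHomogeneous_killVars' {q : MvPolynomial σ K} {m : ℕ} (hq : q.IsHomogeneous m) :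
    (killVars C q).IsHomogeneous m := by
  have hval : ∀ i, ((fun i => if i ∈ C then (0 : MvPolynomial σ K) else X i) i).IsHomogeneous 1 := fun i => by
    dsimp only
    split_ifs
    · exact isHomogeneous_zero σ K 1
    · exact isHomogeneous_X K i
  have h := hq.aeval _ hval
  rwa [one_mul] at h

/-- `G − G|_{x_C = 0} ∈ (x_i : i ∈ C)`. [folklore] -/
private theorem sub_killVars_mem_span' (G : MvPolynomial σ K) :
    G - killVars C G ∈ Ideal.span (X '' C : Set (MvPolynomial σ K)) :=
  Literature.RingTheory.MvPolynomial.sub_aeval_ite_mem_ideal_span C G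

/-- `killVars C` kills the ideal `(x_i : i ∈ C)`. [folklore] -/
private theorem killVars_eq_zero_of_mem_span {p : MvPolynomial σ K}
    (hp : p ∈ Ideal.span (X '' C : Set (MvPolynomial σ K))) : killVars (K := K) C p = 0 := by
  have h := Ideal.mem_map_of_mem (killVars (K := K) C) hp
  rw [Ideal.map_span] at h
  have hle : Ideal.span ((killVars (K := K) C) '' (X '' C : Set (MvPolynomial σ K))) ≤ ⊥ :=
    Ideal.span_le.mpr (by
      rintro _ ⟨_, ⟨i, hi, rfl⟩, rfl⟩
      simp [killVars, hi])
  exact (Submodule.mem_bot _).mp (hle h)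

/-- `killVars C` maps polynomials in the variables of `T` to polynomials in the variables of `T ∖ C`. [folklore] -/
private theorem killVars_mem_supported (T : Set σ) {q : MvPolynomial σ K} (hq : q ∈ supported K T) :
    killVars C q ∈ supported K (T \ C) := by
  rw [supported_eq_adjoin_X] at hq ⊢
  have h : killVars C q ∈ (Algebra.adjoin K (X '' T : Set (MvPolynomial σ K))).map (killVars (K := K) C) :=
    Subalgebra.mem_map.mpr ⟨q, hq, rfl⟩
  rw [AlgHom.map_adjoin] at h
  refine (Algebra.adjoin_le ?_ : Algebra.adjoin K _ ≤ Algebra.adjoin K (X '' (T \ C) : Set (MvPolynomial σ K))) h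
  rintro _ ⟨_, ⟨i, hiT, rfl⟩, rfl⟩
  simp only [SetLike.mem_coe, killVars_X']
  split_ifs with hiC
  · exact Subalgebra.zero_mem _
  · exact Algebra.subset_adjoin ⟨i, ⟨hiT, hiC⟩, rfl⟩

variable {C}

/-- The substitution keeping the variables of `U` and killing the others lands in `K[x_U]`. [folklore] -/
private theorem aeval_ite_mem_supported (U : Set σ) [DecidablePred (· ∈ U)] (q : MvPolynomial σ K) :
    aeval (fun i => if i ∈ U then (X i : MvPolynomial σ K) else 0) q ∈ supported K U := by
  have hrange : aeval (fun i => if i ∈ U then (X i : MvPolynomial σ K) else 0) q ∈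
      (aeval (R := K) fun i => if i ∈ U then (X i : MvPolynomial σ K) else 0).range := ⟨q, rfl⟩
  rw [← Algebra.adjoin_range_eq_range_aeval] at hrange
  refine (Algebra.adjoin_le ?_ : Algebra.adjoin K _ ≤ supported K U) hrange
  rintro _ ⟨i, rfl⟩
  simp only [SetLike.mem_coe]
  split_ifs with hiU
  · exact (supported_eq_adjoin_X (R := K) U).symm ▸ Algebra.subset_adjoin ⟨i, hiU, rfl⟩
  · exact Subalgebra.zero_mem _

/-- … and preserves forms of degree `m`. [folklore] -/
private theorem isHomogeneous_aeval_ite {U : Set σ} [DecidablePred (· ∈ U)] {q : MvPolynomial σ K} {m : ℕ}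
    (hq : q.IsHomogeneous m) : (aeval (fun i => if i ∈ U then (X i : MvPolynomial σ K) else 0) q).IsHomogeneous m := by
  have hval : ∀ i, ((fun i => if i ∈ U then (X i : MvPolynomial σ K) else 0) i).IsHomogeneous 1 := fun i => by
    dsimp only
    split_ifs
    · exact isHomogeneous_X K i
    · exact isHomogeneous_zero σ K 1
  have h := hq.aeval _ hval
  rwa [one_mul] at h

variable {k c r : ℕ}

/-- An algebra automorphism of the polynomial ring is the substitution of the images of the variables. [folklore] -/
private theorem algEquiv_eq_aeval' {n : ℕ} (φ : MvPolynomial (Fin n) K ≃ₐ[K] MvPolynomial (Fin n) K)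
    (F : MvPolynomial (Fin n) K) : φ F = aeval (fun l => φ (X l)) F := by
  have h : (φ : MvPolynomial (Fin n) K →ₐ[K] MvPolynomial (Fin n) K) = aeval fun l => φ (X l) :=
    MvPolynomial.algHom_ext fun l => by simp
  exact congr($h F)

/-- **Transport.** A linear change of coordinates `φ` maps a form split with respect to `g, h, g'` to a form split with
respect to `φ(g), φ(h), φ(g')`. [cite: Kloosterman2025, Definition 5.1] -/
theorem IsSplit.map {d : ℕ} (φ : MvPolynomial (Fin (2 * k + 2)) K ≃ₐ[K] MvPolynomial (Fin (2 * k + 2)) K)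
    (hφ1 : ∀ l, (φ (X l)).IsHomogeneous 1) {gA h : Fin c → MvPolynomial (Fin (2 * k + 2)) K}
    {gC : Fin r → MvPolynomial (Fin (2 * k + 2)) K} {F : MvPolynomial (Fin (2 * k + 2)) K}
    (hF : IsSplit d gA h gC F) :
    IsSplit d (fun i => φ (gA i)) (fun j => φ (h j)) (fun m => φ (gC m)) (φ F) := by
  classical
  obtain ⟨Q, P, hQ, hP, hQadj, rfl⟩ := hF
  refine ⟨fun i j => φ (Q i j), fun m => φ (P m), fun i j => ?_, fun m => ?_, fun i j => ?_, ?_⟩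
  · show (φ (Q i j)).IsHomogeneous (d - 2)
    rw [algEquiv_eq_aeval']
    exact Literature.RingTheory.MvPolynomial.isHomogeneous_aeval_linear hφ1 (hQ i j)
  · show (φ (P m)).IsHomogeneous (d - 1)
    rw [algEquiv_eq_aeval']
    exact Literature.RingTheory.MvPolynomial.isHomogeneous_aeval_linear hφ1 (hP m)
  · have hmem : φ (Q i j) ∈ (Algebra.adjoin K (Set.range gA ∪ Set.range h)).map
        (φ : MvPolynomial (Fin (2 * k + 2)) K →ₐ[K] MvPolynomial (Fin (2 * k + 2)) K) :=
      Subalgebra.mem_map.mpr ⟨Q i j, hQadj i j, rfl⟩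
    rw [AlgHom.map_adjoin] at hmem
    refine Algebra.adjoin_mono ?_ hmem
    rintro _ ⟨q, hq, rfl⟩
    rcases hq with ⟨i', rfl⟩ | ⟨j', rfl⟩
    · exact Or.inl ⟨i', rfl⟩
    · exact Or.inr ⟨j', rfl⟩
  · simp only [twoPlanesForm, map_add, map_sum, map_mul]

/-- **Invariance in adapted coordinates.** If the target equations are coordinate variables `x_{e(A)}, x_{e(B)},
x_{e(C)}` (an injective placement `e`) and the source equations `g₁, h₁` (`c` each), `g₁'` (`r`) are linear forms
cutting out the same two planes (`(g₁, g₁') = (x_A, x_C)`, `(h₁, g₁') = (x_B, x_C)` as ideals), then a form split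
with respect to `g₁, h₁, g₁'` is split with respect to `x_A, x_B, x_C`: kill the variables `x_C` (the `Q`-part lands
in `K[x_A, x_B]`, normal form with `r = 0`), and the difference lies in `(x_C)` (normal form with `c = 0`).
[cite: Kloosterman2025, Definition 5.1, Remark 5.2] -/
theorem IsSplit.of_span_eq_span_X {d : ℕ} (hd : 2 ≤ d) (e : (Fin c ⊕ Fin c) ⊕ Fin r ↪ Fin (2 * k + 2))
    {g₁ h₁ : Fin c → MvPolynomial (Fin (2 * k + 2)) K} {g₁' : Fin r → MvPolynomial (Fin (2 * k + 2)) K}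
    (hg₁ : ∀ i, (g₁ i).IsHomogeneous 1) (hh₁ : ∀ j, (h₁ j).IsHomogeneous 1) (hg₁' : ∀ m, (g₁' m).IsHomogeneous 1)
    (hI₁ : Ideal.span (Set.range g₁ ∪ Set.range g₁') =
      Ideal.span (Set.range (fun i => (X (e (Sum.inl (Sum.inl i))) : MvPolynomial (Fin (2 * k + 2)) K)) ∪
        Set.range (fun m => X (e (Sum.inr m)))))
    (hI₂ : Ideal.span (Set.range h₁ ∪ Set.range g₁') =
      Ideal.span (Set.range (fun j => (X (e (Sum.inl (Sum.inr j))) : MvPolynomial (Fin (2 * k + 2)) K)) ∪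
        Set.range (fun m => X (e (Sum.inr m)))))
    {F : MvPolynomial (Fin (2 * k + 2)) K} (hF : IsSplit d g₁ h₁ g₁' F) :
    IsSplit d (fun i => X (e (Sum.inl (Sum.inl i)))) (fun j => X (e (Sum.inl (Sum.inr j))))
      (fun m => X (e (Sum.inr m))) F := by
  classical
  have hFhom : F.IsHomogeneous d := hF.isHomogeneous hd hg₁ hh₁ hg₁'
  obtain ⟨Q, P, hQ, hP, hQadj, hFeq⟩ := hF
  -- the three blocks of coordinates
  set xA : Fin c → MvPolynomial (Fin (2 * k + 2)) K := fun i => X (e (Sum.inl (Sum.inl i))) with hxA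
  set xB : Fin c → MvPolynomial (Fin (2 * k + 2)) K := fun j => X (e (Sum.inl (Sum.inr j))) with hxB
  set xC : Fin r → MvPolynomial (Fin (2 * k + 2)) K := fun m => X (e (Sum.inr m)) with hxC
  set A : Set (Fin (2 * k + 2)) := Set.range fun i => e (Sum.inl (Sum.inl i)) with hA
  set B : Set (Fin (2 * k + 2)) := Set.range fun j => e (Sum.inl (Sum.inr j)) with hB
  set C : Set (Fin (2 * k + 2)) := Set.range fun m => e (Sum.inr m) with hC
  have hXA : (X '' A : Set (MvPolynomial (Fin (2 * k + 2)) K)) = Set.range xA := (Set.range_comp X _).symm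
  have hXB : (X '' B : Set (MvPolynomial (Fin (2 * k + 2)) K)) = Set.range xB := (Set.range_comp X _).symm
  have hXC : (X '' C : Set (MvPolynomial (Fin (2 * k + 2)) K)) = Set.range xC := (Set.range_comp X _).symm
  have hXAC : (X '' (A ∪ C) : Set (MvPolynomial (Fin (2 * k + 2)) K)) = Set.range xA ∪ Set.range xC := by
    rw [Set.image_union, hXA, hXC]
  have hXBC : (X '' (B ∪ C) : Set (MvPolynomial (Fin (2 * k + 2)) K)) = Set.range xB ∪ Set.range xC := by
    rw [Set.image_union, hXB, hXC]
  have hAB : Disjoint A B := by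
    refine Set.disjoint_left.mpr ?_
    rintro _ ⟨i, rfl⟩ ⟨j, hj⟩
    exact absurd (Sum.inl.inj (e.injective hj)) Sum.inr_ne_inl
  have hAC : Disjoint A C := by
    refine Set.disjoint_left.mpr ?_
    rintro _ ⟨i, rfl⟩ ⟨m, hm⟩
    exact absurd (e.injective hm) Sum.inr_ne_inl
  have hBC : Disjoint B C := by
    refine Set.disjoint_left.mpr ?_
    rintro _ ⟨j, rfl⟩ ⟨m, hm⟩
    exact absurd (e.injective hm) Sum.inr_ne_inl
  -- (1) the variables of the source equations
  have hvg₁ : ∀ i, (↑(g₁ i).vars : Set (Fin (2 * k + 2))) ⊆ A ∪ C := fun i =>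
    vars_subset_of_mem_span_X (hg₁ i) (by rw [hXAC, ← hI₁]; exact Ideal.subset_span (Or.inl ⟨i, rfl⟩))
  have hvh₁ : ∀ j, (↑(h₁ j).vars : Set (Fin (2 * k + 2))) ⊆ B ∪ C := fun j =>
    vars_subset_of_mem_span_X (hh₁ j) (by rw [hXBC, ← hI₂]; exact Ideal.subset_span (Or.inl ⟨j, rfl⟩))
  have hvg₁' : ∀ m, (↑(g₁' m).vars : Set (Fin (2 * k + 2))) ⊆ C := fun m l hl => by
    have hlAC : l ∈ A ∪ C :=
      vars_subset_of_mem_span_X (hg₁' m) (by rw [hXAC, ← hI₁]; exact Ideal.subset_span (Or.inr ⟨m, rfl⟩)) hl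
    have hlBC : l ∈ B ∪ C :=
      vars_subset_of_mem_span_X (hg₁' m) (by rw [hXBC, ← hI₂]; exact Ideal.subset_span (Or.inr ⟨m, rfl⟩)) hl
    rcases hlAC with hlA | hlC
    · rcases hlBC with hlB | hlC
      · exact absurd hlB (Set.disjoint_left.mp hAB hlA)
      · exact hlC
    · exact hlC
  -- (2) kill the coordinates `x_C`
  let κ := killVars (K := K) C
  have hκg : ∀ i, κ (g₁ i) ∈ supported K A := fun i => by
    refine supported_mono ?_ (killVars_mem_supported C (A ∪ C) (mem_supported.mpr (hvg₁ i)))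
    rw [Set.union_sdiff_right]
    exact Set.sdiff_subset
  have hκh : ∀ j, κ (h₁ j) ∈ supported K B := fun j => by
    refine supported_mono ?_ (killVars_mem_supported C (B ∪ C) (mem_supported.mpr (hvh₁ j)))
    rw [Set.union_sdiff_right]
    exact Set.sdiff_subset
  have hκg' : ∀ m, κ (g₁' m) = 0 := fun m =>
    killVars_eq_zero_of_mem_span C (mem_span_X_of_vars_subset (hg₁' m) (hvg₁' m))
  have hκQ : ∀ i j, κ (Q i j) ∈ supported K (A ∪ B) := fun i j => by
    have hmem : κ (Q i j) ∈ (Algebra.adjoin K (Set.range g₁ ∪ Set.range h₁)).map κ :=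
      Subalgebra.mem_map.mpr ⟨Q i j, hQadj i j, rfl⟩
    rw [AlgHom.map_adjoin] at hmem
    refine (Algebra.adjoin_le ?_ : Algebra.adjoin K _ ≤ supported K (A ∪ B)) hmem
    rintro _ ⟨q, hq, rfl⟩
    rcases hq with ⟨i', rfl⟩ | ⟨j', rfl⟩
    · exact supported_mono Set.subset_union_left (hκg i')
    · exact supported_mono Set.subset_union_right (hκh j')
  -- (3) `G = F|_{x_C = 0}` lies in `K[x_A, x_B] ∩ (x_A) ∩ (x_B)`, and `F − G ∈ (x_C)`
  set G := κ F with hG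
  have hGexp : G = ∑ i, ∑ j, κ (g₁ i) * κ (h₁ j) * κ (Q i j) := by
    rw [hG, ← hFeq, twoPlanesForm, map_add, map_sum, map_sum]
    simp only [map_sum, map_mul, hκg', zero_mul, Finset.sum_const_zero, add_zero]
  have hGhom : G.IsHomogeneous d := isHomogeneous_killVars' C hFhom
  have hGsupp : G ∈ supported K (A ∪ B) := by
    rw [hGexp]
    refine Subalgebra.sum_mem _ fun i _ => Subalgebra.sum_mem _ fun j _ => Subalgebra.mul_mem _ (Subalgebra.mul_mem _
      (supported_mono Set.subset_union_left (hκg i)) (supported_mono Set.subset_union_right (hκh j))) (hκQ i j)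
  have hGA : G ∈ Ideal.span (Set.range xA) := by
    rw [hGexp, ← hXA]
    refine Ideal.sum_mem _ fun i _ => Ideal.sum_mem _ fun j _ => Ideal.mul_mem_right _ _ (Ideal.mul_mem_right _ _ ?_)
    exact mem_span_X_of_vars_subset (isHomogeneous_killVars' C (hg₁ i)) (mem_supported.mp (hκg i))
  have hGB : G ∈ Ideal.span (Set.range xB) := by
    rw [hGexp, ← hXB]
    refine Ideal.sum_mem _ fun i _ => Ideal.sum_mem _ fun j _ => Ideal.mul_mem_right _ _ (Ideal.mul_mem_left _ _ ?_)
    exact mem_span_X_of_vars_subset (isHomogeneous_killVars' C (hh₁ j)) (mem_supported.mp (hκh j))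
  have hFG : F - G ∈ Ideal.span (Set.range xC) := by rw [← hXC]; exact sub_killVars_mem_span' C F
  -- (4) normal form of `G` with `r = 0`: `G = Σ x_A x_B Q'`
  have hliAB : LinearIndependent K (Sum.elim (Sum.elim xA xB) (Fin.elim0 : Fin 0 → MvPolynomial (Fin (2 * k + 2)) K)) := by
    let f : (Fin c ⊕ Fin c) ⊕ Fin 0 → Fin (2 * k + 2) :=
      Sum.elim (Sum.elim (fun i => e (Sum.inl (Sum.inl i))) (fun j => e (Sum.inl (Sum.inr j)))) Fin.elim0
    have hf : Function.Injective f := by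
      rintro ((i | j) | m) ((i' | j') | m') hst <;> first | exact m.elim0 | exact m'.elim0 | skip
      · rw [Sum.inl.inj (Sum.inl.inj (e.injective hst))]
      · exact absurd (Sum.inl.inj (e.injective hst)) Sum.inl_ne_inr
      · exact absurd (Sum.inl.inj (e.injective hst)) Sum.inr_ne_inl
      · rw [Sum.inr.inj (Sum.inl.inj (e.injective hst))]
    have hfe : Sum.elim (Sum.elim xA xB) (Fin.elim0 : Fin 0 → MvPolynomial (Fin (2 * k + 2)) K) = fun s => X (f s) := by
      funext s
      rcases s with ((i | j) | m)
      · rfl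
      · rfl
      · exact m.elim0
    rw [hfe]
    exact (MvPolynomial.linearIndependent_X (σ := Fin (2 * k + 2)) (R := K)).comp f hf
  obtain ⟨Q', P', hQ', -, hGeq⟩ := exists_twoPlanesForm_eq_of_mem hd xA xB Fin.elim0 (fun i => isHomogeneous_X K _)
    (fun j => isHomogeneous_X K _) (fun m => m.elim0) hliAB hGhom
    (Ideal.span_mono Set.subset_union_left hGA) (Ideal.span_mono Set.subset_union_left hGB)
  have hGsum : G = ∑ i, ∑ j, xA i * xB j * Q' i j := by
    rw [← hGeq, twoPlanesForm, Fin.sum_univ_zero, add_zero]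
  -- keep only the variables of `A ∪ B` in `Q'`
  let ρ : MvPolynomial (Fin (2 * k + 2)) K →ₐ[K] MvPolynomial (Fin (2 * k + 2)) K :=
    aeval fun l => if l ∈ A ∪ B then X l else 0
  have hρA : ∀ i, ρ (xA i) = xA i := fun i => by
    simp only [ρ, hxA, aeval_X]; exact if_pos (Or.inl ⟨i, rfl⟩)
  have hρB : ∀ j, ρ (xB j) = xB j := fun j => by
    simp only [ρ, hxB, aeval_X]; exact if_pos (Or.inr ⟨j, rfl⟩)
  have hρG : ρ G = G := aeval_ite_mem_eq_self G (mem_supported.mp hGsupp)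
  have hGsum' : G = ∑ i, ∑ j, xA i * xB j * ρ (Q' i j) := by
    conv_lhs => rw [← hρG, hGsum]
    simp only [map_sum, map_mul, hρA, hρB]
  -- (5) normal form of `F − G ∈ (x_C)` with `c = 0`: `F − G = Σ x_C P''`
  have hliC : LinearIndependent K (Sum.elim (Sum.elim (Fin.elim0 : Fin 0 → MvPolynomial (Fin (2 * k + 2)) K) Fin.elim0) xC) := by
    let f : (Fin 0 ⊕ Fin 0) ⊕ Fin r → Fin (2 * k + 2) := Sum.elim (Sum.elim Fin.elim0 Fin.elim0) fun m => e (Sum.inr m)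
    have hf : Function.Injective f := by
      rintro ((i | j) | m) ((i' | j') | m') hst <;> first | exact i.elim0 | exact j.elim0 | exact i'.elim0 | exact j'.elim0 | skip
      rw [Sum.inr.inj (e.injective hst)]
    have hfe : Sum.elim (Sum.elim (Fin.elim0 : Fin 0 → MvPolynomial (Fin (2 * k + 2)) K) Fin.elim0) xC =
        fun s => X (f s) := by
      funext s
      rcases s with ((i | j) | m)
      · exact i.elim0
      · exact j.elim0
      · rfl
    rw [hfe]
    exact (MvPolynomial.linearIndependent_X (σ := Fin (2 * k + 2)) (R := K)).comp f hf
  obtain ⟨Q'', P'', -, hP'', hHeq⟩ := exists_twoPlanesForm_eq_of_mem hd Fin.elim0 Fin.elim0 xC (fun i => i.elim0)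
    (fun j => j.elim0) (fun m => isHomogeneous_X K _) hliC (hFhom.sub hGhom)
    (Ideal.span_mono Set.subset_union_right hFG) (Ideal.span_mono Set.subset_union_right hFG)
  have hHsum : F - G = ∑ m, xC m * P'' m := by
    rw [← hHeq, twoPlanesForm, Fin.sum_univ_zero, zero_add]
  -- (6) assemble
  refine ⟨fun i j => ρ (Q' i j), P'', fun i j => isHomogeneous_aeval_ite (hQ' i j), hP'', fun i j => ?_, ?_⟩
  · have hsupp : ρ (Q' i j) ∈ supported K (A ∪ B) := aeval_ite_mem_supported (A ∪ B) (Q' i j)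
    rw [supported_eq_adjoin_X, Set.image_union, hXA, hXB] at hsupp
    exact hsupp
  · rw [twoPlanesForm, ← hGsum', ← hHsum]
    ring

/-- **Invariance: `IsSplit` depends only on the pair of planes, not on their equations.** If `g₀, h₀, g₀'` and
`g, h, g'` are linear forms cutting out the same planes — `(g₀, g₀') = (g, g')` and `(h₀, g₀') = (h, g')` as ideals,
i.e. `Π₁ = V(g₀, g₀') = V(g, g')`, `Π₂ = V(h₀, g₀') = V(h, g')` — with `g, h, g'` linearly independent, then a form split
with respect to `g₀, h₀, g₀'` is split with respect to `g, h, g'`. Hence Definition 5.1 — "there exist a coordinate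
transformation of `ℙ^{2k+1}` such that …" (coordinates adapted to the pair `Π₁, Π₂`) — is captured by `IsSplit` for ANY
fixed choice of equations (`isSplit_iff_exists_algEquiv`). [cite: Kloosterman2025, Definition 5.1, Remark 5.2] -/
theorem IsSplit.of_span_eq {d : ℕ} (hd : 2 ≤ d)
    {g₀ h₀ : Fin c → MvPolynomial (Fin (2 * k + 2)) K} {g₀' : Fin r → MvPolynomial (Fin (2 * k + 2)) K}
    (hg₀ : ∀ i, (g₀ i).IsHomogeneous 1) (hh₀ : ∀ j, (h₀ j).IsHomogeneous 1) (hg₀' : ∀ m, (g₀' m).IsHomogeneous 1)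
    {gA h : Fin c → MvPolynomial (Fin (2 * k + 2)) K} {gC : Fin r → MvPolynomial (Fin (2 * k + 2)) K}
    (hgA : ∀ i, (gA i).IsHomogeneous 1) (hh : ∀ j, (h j).IsHomogeneous 1) (hgC : ∀ m, (gC m).IsHomogeneous 1)
    (hli : LinearIndependent K (Sum.elim (Sum.elim gA h) gC))
    (h₁ : Ideal.span (Set.range g₀ ∪ Set.range g₀') = Ideal.span (Set.range gA ∪ Set.range gC))
    (h₂ : Ideal.span (Set.range h₀ ∪ Set.range g₀') = Ideal.span (Set.range h ∪ Set.range gC))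
    {F : MvPolynomial (Fin (2 * k + 2)) K} (hF : IsSplit d g₀ h₀ g₀' F) : IsSplit d gA h gC F := by
  classical
  have h1 : ∀ s, (Sum.elim (Sum.elim gA h) gC s).IsHomogeneous 1 := by
    rintro ((i | j) | m)
    · exact hgA i
    · exact hh j
    · exact hgC m
  obtain ⟨ψ, e, hψ, hψ1, hψs1⟩ := exists_algEquiv_X_eq _ h1 hli
  have hsA : ∀ i, ψ.symm (gA i) = X (e (Sum.inl (Sum.inl i))) := fun i => by
    rw [AlgEquiv.symm_apply_eq]; exact (hψ (Sum.inl (Sum.inl i))).symm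
  have hsB : ∀ j, ψ.symm (h j) = X (e (Sum.inl (Sum.inr j))) := fun j => by
    rw [AlgEquiv.symm_apply_eq]; exact (hψ (Sum.inl (Sum.inr j))).symm
  have hsC : ∀ m, ψ.symm (gC m) = X (e (Sum.inr m)) := fun m => by
    rw [AlgEquiv.symm_apply_eq]; exact (hψ (Sum.inr m)).symm
  -- transport the ideal equalities by `ψ⁻¹`
  have hmap : ∀ (u : Fin c → MvPolynomial (Fin (2 * k + 2)) K) (v : Fin r → MvPolynomial (Fin (2 * k + 2)) K),
      Ideal.map (ψ.symm : MvPolynomial (Fin (2 * k + 2)) K →ₐ[K] MvPolynomial (Fin (2 * k + 2)) K)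
        (Ideal.span (Set.range u ∪ Set.range v)) =
        Ideal.span (Set.range (fun i => ψ.symm (u i)) ∪ Set.range (fun m => ψ.symm (v m))) := fun u v => by
    rw [Ideal.map_span, Set.image_union, ← Set.range_comp, ← Set.range_comp]; rfl
  have h₁' := congrArg (Ideal.map (ψ.symm : MvPolynomial (Fin (2 * k + 2)) K →ₐ[K] MvPolynomial (Fin (2 * k + 2)) K)) h₁
  have h₂' := congrArg (Ideal.map (ψ.symm : MvPolynomial (Fin (2 * k + 2)) K →ₐ[K] MvPolynomial (Fin (2 * k + 2)) K)) h₂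
  rw [hmap, hmap] at h₁' h₂'
  simp only [hsA, hsB, hsC] at h₁' h₂'
  -- source data in the adapted coordinates
  have hlin : ∀ {q : MvPolynomial (Fin (2 * k + 2)) K}, q.IsHomogeneous 1 → (ψ.symm q).IsHomogeneous 1 := fun hq => by
    rw [algEquiv_eq_aeval']; exact Literature.RingTheory.MvPolynomial.isHomogeneous_aeval_linear hψs1 hq
  have hcoord := IsSplit.of_span_eq_span_X hd e (fun i => hlin (hg₀ i)) (fun j => hlin (hh₀ j))
    (fun m => hlin (hg₀' m)) h₁' h₂' (hF.map ψ.symm hψs1)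
  -- back by `ψ`
  have hback := hcoord.map ψ hψ1
  simp only [AlgEquiv.apply_symm_apply, hψ, Sum.elim_inl, Sum.elim_inr] at hback
  exact hback

/-- The coordinates `x_0, …, x_{2c−1}` are exactly the placed `g`- and `h`-coordinates of `stdPlacement`. [folklore] -/
private theorem image_X_lt_two_mul_subset (hcr : c + r = k + 1) :
    (X '' {l : Fin (2 * k + 2) | (l : ℕ) < 2 * c} : Set (MvPolynomial (Fin (2 * k + 2)) K)) ⊆
      Set.range (fun i => X (stdPlacement hcr (Sum.inl (Sum.inl i)))) ∪
        Set.range (fun j => X (stdPlacement hcr (Sum.inl (Sum.inr j)))) := by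
  rintro _ ⟨l, hl, rfl⟩
  rw [Set.mem_setOf_eq] at hl
  by_cases hlc : (l : ℕ) < c
  · refine Or.inl ⟨⟨l, hlc⟩, ?_⟩
    exact congrArg X (Fin.ext rfl)
  · refine Or.inr ⟨⟨l - c, by omega⟩, ?_⟩
    exact congrArg X (Fin.ext (by simp only [stdPlacement_inl_inr]; omega))

/-- **Definition 5.1 as printed ⇔ `IsSplit`.** For linearly independent linear forms `g, h, g'` (`c + r = k + 1`)
and any `F`: `F` is split of codimension `c` with respect to `g, h, g'` iff there is a linear change of coordinates `φ`
ADAPTED TO THE PAIR OF PLANES — `φ` maps the coordinate planes `V(x_0..x_{c−1}, x_{k+c+1}..x_{2k+1})` and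
`V(x_c..x_{2c−1}, x_{k+c+1}..x_{2k+1})` to `Π₁ = V(g, g')` and `Π₂ = V(h, g')` (equal ideals) — and forms `Q_{ij}` with
`Q_{ij} ∈ K[x_0, …, x_{2c−1}]`, `P_m`, such that `φ⁻¹(F) = Σ_{i<c} Σ_{j<c} x_i x_{c+j} Q_{ij} + Σ_m x_{k+c+1+m} P_m` ("there
exist a coordinate transformation of `ℙ^{2k+1}` such that `X` is the zero set of `f = Σ x_i x_j Q_{ij} + Σ x_j P_j` and
`Q_{ij} ∈ ℂ[x_0,…,x_{2c−1}]`"). [cite: Kloosterman2025, Definition 5.1, Remark 5.2] -/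
theorem isSplit_iff_exists_algEquiv {d : ℕ} (hd : 2 ≤ d) (hcr : c + r = k + 1)
    {gA h : Fin c → MvPolynomial (Fin (2 * k + 2)) K} {gC : Fin r → MvPolynomial (Fin (2 * k + 2)) K}
    (hgA : ∀ i, (gA i).IsHomogeneous 1) (hh : ∀ j, (h j).IsHomogeneous 1) (hgC : ∀ m, (gC m).IsHomogeneous 1)
    (hli : LinearIndependent K (Sum.elim (Sum.elim gA h) gC)) {F : MvPolynomial (Fin (2 * k + 2)) K} :
    IsSplit d gA h gC F ↔
      ∃ (φ : MvPolynomial (Fin (2 * k + 2)) K ≃ₐ[K] MvPolynomial (Fin (2 * k + 2)) K)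
        (Q : Fin c → Fin c → MvPolynomial (Fin (2 * k + 2)) K) (P : Fin r → MvPolynomial (Fin (2 * k + 2)) K),
        (∀ l, (φ (X l)).IsHomogeneous 1) ∧ (∀ l, (φ.symm (X l)).IsHomogeneous 1) ∧
        Ideal.span (Set.range (fun i => φ (X (stdPlacement hcr (Sum.inl (Sum.inl i))))) ∪
            Set.range (fun m => φ (X (stdPlacement hcr (Sum.inr m))))) = Ideal.span (Set.range gA ∪ Set.range gC) ∧
        Ideal.span (Set.range (fun j => φ (X (stdPlacement hcr (Sum.inl (Sum.inr j))))) ∪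
            Set.range (fun m => φ (X (stdPlacement hcr (Sum.inr m))))) = Ideal.span (Set.range h ∪ Set.range gC) ∧
        (∀ i j, (Q i j).IsHomogeneous (d - 2)) ∧ (∀ m, (P m).IsHomogeneous (d - 1)) ∧
        (∀ i j, ∀ l ∈ (Q i j).vars, (l : ℕ) < 2 * c) ∧
        φ.symm F = twoPlanesForm (fun i => X (stdPlacement hcr (Sum.inl (Sum.inl i))))
          (fun j => X (stdPlacement hcr (Sum.inl (Sum.inr j)))) (fun m => X (stdPlacement hcr (Sum.inr m))) Q P := by
  classical
  constructor
  · intro hF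
    obtain ⟨φ, Q, P, hφ1, hφs1, hA, hB, hC, hQ, hP, hvars, hFeq⟩ := hF.exists_algEquiv_positions hcr hgA hh hgC hli
    refine ⟨φ, Q, P, hφ1, hφs1, ?_, ?_, hQ, hP, hvars, hFeq⟩
    · simp only [hA, hC]
    · simp only [hB, hC]
  · rintro ⟨φ, Q, P, hφ1, hφs1, hI₁, hI₂, hQ, hP, hvars, hFeq⟩
    -- `φ⁻¹ F` is split with respect to the coordinate planes
    have hsplit : IsSplit d (fun i => X (stdPlacement hcr (Sum.inl (Sum.inl i))))
        (fun j => X (stdPlacement hcr (Sum.inl (Sum.inr j)))) (fun m => X (stdPlacement hcr (Sum.inr m))) (φ.symm F) := by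
      refine ⟨Q, P, hQ, hP, fun i j => ?_, hFeq.symm⟩
      have hsupp : Q i j ∈ supported K {l : Fin (2 * k + 2) | (l : ℕ) < 2 * c} :=
        mem_supported.mpr fun l hl => hvars i j l hl
      rw [supported_eq_adjoin_X] at hsupp
      exact Algebra.adjoin_mono (image_X_lt_two_mul_subset hcr) hsupp
    -- transport by `φ` and change the equations
    have hφF := hsplit.map φ hφ1
    rw [AlgEquiv.apply_symm_apply] at hφF
    exact hφF.of_span_eq hd (fun i => hφ1 _) (fun j => hφ1 _) (fun m => hφ1 _) hgA hh hgC hli hI₁ hI₂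

end Invariance

end Literature.AlgebraicGeometry.Kloosterman2025

end
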